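/-
Copyright (c) 2026 the pub-hodgecm-mathlib formalisation cell (harness21).  Prover seat hodgecm-mathlib-K2Liu-p05 (g4), 2026-09-04
(Track B «K2-LIT», crux hLiu418 = stmt-HodgeConjecture-24832, LEAD F0P6-plan (g13) RULING M-157m (1) organ (SD-1-ind), glue (II)→(III):
a right-`K_w`-finite function is a polynomial in the matrix entries and their conjugates on `K_w`).
-/
import Summits.HodgeConjecture.HodgeConjecture.Theorems.K2LiuCompactUnitaryFiniteFunctionsPolynomial    -- ★ (K∞-str) F2 (this seat)
import Summits.HodgeConjecture.HodgeConjecture.Theorems.K2LiuSiegelStabSubgroup                          -- ★ (SD-1-ind) (II) (K2Liu-p11 (g0))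
import HarnessLib

/-!
# (SD-1-ind, II→III glue) Right-`K_w`-finite functions are polynomial in the entries and their conjugates on `K_w`

Track B ∕ K2-LIT, hLiu418 = stmt-HodgeConjecture-24832; LEAD F0P6-plan (g13) RULING M-157m (1).  Namespace
`Summit.HodgeConjecture.HodgeConjecture.Cruxes.HLiu418.K2LiuKFinitePolynomialOnSiegelStab`.  THEOREMS ONLY; `--supports stmt-HodgeConjecture-24832 --as helper`.

`exists_mvPolynomial_of_rightKFinite`: if `f : M_{2l}(ℂ) → ℂ` is continuous on the stabiliser `K_w = U(J) ∩ Stab(i1)` (K2Liu-p11 (g0)'s ★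
`siegelStabSubgroup l ≤ unitaryGroup (l ⊕ l) ℂ`, closed) and the right `K_w`-translates of `f` span a finite-dimensional space, then there is ONE polynomial
`P` with `f u = P(u_{pq}, conj u_{pq})` for every `u ∈ U(J)` with `u · i1 = i1` — precisely the hypothesis `hF2` of ★ (III)
`K2LiuKFiniteSectionAtWeylTranslate.exists_mvPolynomial_section_J_mul_transl` and ★ (IV-b) `exists_xiTwoIntegrand_moments`.
PROOF: ★ F2 `exists_mvPolynomial_of_finiteDimensional_span_rightTranslates` on `K := siegelStabSubgroup l` (closed: ★ `isClosed_siegelStabSubgroup`;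
finite-dimensionality transported by ★ `finiteDimensional_span_rightTranslates_restrict`; points of `K_w` by ★ `exists_mem_coe_eq`).

HONEST LABEL: HC_CM is proved only modulo the 7 printed citations (2 remaining named inputs: hLiu418 = stmt-HodgeConjecture-24832, h413 =
stmt-HodgeConjecture-24833) until rung 0 closes; organ capital, moves no counter.

## References
[WallachRRG1] N. Wallach, *Real Reductive Groups I* (1988), §3.3 (K-finite vectors) · [Shimura1997] G. Shimura, *Euler Products and Eisenstein Series*, §16.
-/

set_option autoImplicit false
set_option linter.dupNamespace false

noncomputable section

open scoped Matrix ComplexConjugate ComplexOrder MatrixOrder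
open Complex Matrix
open Literature.NumberTheory.ModularForms.SiegelUpperHalfSpace (moeb)
open Summit.HodgeConjecture.HodgeConjecture.Cruxes.HLiu418.K2LiuCompactGroupFiniteFunctions
open Summit.HodgeConjecture.HodgeConjecture.Cruxes.HLiu418.K2LiuSiegelStabSubgroup

namespace Summit.HodgeConjecture.HodgeConjecture.Cruxes.HLiu418.K2LiuKFinitePolynomialOnSiegelStab

variable {l : Type} [Fintype l] [DecidableEq l]  -- universe `0`: ★ F2 is stated for index types in `Type`

/-- **RIGHT-`K_w`-FINITE ⇒ POLYNOMIAL ON `K_w`.**  For `f : M_{2l}(ℂ) → ℂ` continuous on `K_w` whose right `K_w`-translates span a finite-dimensional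
space, one polynomial `P` in the entries and the conjugate entries represents `f` on `K_w = {u ∈ U(J) : u · i1 = i1}`.
[cite: WallachRRG1, §3.3] [cite: Shimura1997, §16.4] -/
theorem exists_mvPolynomial_of_rightKFinite (f : Matrix (l ⊕ l) (l ⊕ l) ℂ → ℂ)
    (hf : Continuous fun k : siegelStabSubgroup l => f (((k : siegelStabSubgroup l) : Matrix.unitaryGroup (l ⊕ l) ℂ) : Matrix (l ⊕ l) (l ⊕ l) ℂ))
    (hfin : FiniteDimensional ℂ (Submodule.span ℂ (Set.range fun k₀ : siegelStabSubgroup l =>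
      fun g : Matrix (l ⊕ l) (l ⊕ l) ℂ => f (g * ((k₀ : Matrix.unitaryGroup (l ⊕ l) ℂ) : Matrix (l ⊕ l) (l ⊕ l) ℂ))))) :
    ∃ P : MvPolynomial (((l ⊕ l) × (l ⊕ l)) ⊕ ((l ⊕ l) × (l ⊕ l))) ℂ, ∀ u : Matrix (l ⊕ l) (l ⊕ l) ℂ,
      uᴴ * Matrix.J l ℂ * u = Matrix.J l ℂ → moeb u (I • (1 : Matrix l l ℂ)) = I • 1 →
        f u = MvPolynomial.eval (Sum.elim (fun pq : (l ⊕ l) × (l ⊕ l) => u pq.1 pq.2) (fun pq : (l ⊕ l) × (l ⊕ l) => conj (u pq.1 pq.2))) P := by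
  obtain ⟨P, hP⟩ := exists_mvPolynomial_of_finiteDimensional_span_rightTranslates (siegelStabSubgroup l) isClosed_siegelStabSubgroup
    (fun k : siegelStabSubgroup l => f (((k : siegelStabSubgroup l) : Matrix.unitaryGroup (l ⊕ l) ℂ) : Matrix (l ⊕ l) (l ⊕ l) ℂ)) hf
    (finiteDimensional_span_rightTranslates_restrict f hfin)
  refine ⟨P, fun u hu hI => ?_⟩
  obtain ⟨U, hU, rfl⟩ := exists_mem_coe_eq hu hI
  exact hP ⟨U, hU⟩

end Summit.HodgeConjecture.HodgeConjecture.Cruxes.HLiu418.K2LiuKFinitePolynomialOnSiegelStab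

end
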